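import Literature.Probability.RandomPlanarGeometry.HexSAWRotSurfaceDensity
import Literature.Probability.RandomPlanarGeometry.HexSAWRotSurfaceArmchairDictionary
import Literature.Probability.RandomPlanarGeometry.HexSAWArmchairUnfolding
import HarnessLib

/-!
# «HEX-YC-ROT-DENSITY-RATE» Explicit finite-`n` envelopes for Beaton's rotated surface partition function
# `C⁺_n(y)` up to the critical fugacity, and an explicit `O(√n log n)` bound on the mean number of surface
# vertices below it

Topic `Literature/Probability/RandomPlanarGeometry` (continues `HexSAWRotSurfaceDensity.lean` — `HV.rotSurfMoment`,
`HV.rotSurfDensity n y = rotSurfMoment n y / (n C⁺_n(y))`, `HV.rotSurfTail`, `rotSurfMoment_le_add`, `rotSurfTail_le_pow_mul`,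
the QUALITATIVE `tendsto_rotSurfDensity_zero` —, `HexSAWRotSurfaceArmchairDictionary.lean` — the armchair dictionary
`HV.rotHpCoeff_succ_eq : C⁺_{n+1}(y) = C^w_n(y)`, `HV.hexConnectiveConstant_lt_armRate_iff_of_archBound` — and
`HexSAWArmchairUnfolding.lean` — Beaton's fixed-length unfolding `HexBW.Arm.Aw_le_pow`, `HexBW.Arm.archBound_holds`; with the split
at the last wall visit `HexBW.Arm.Cw_le_sum` of `HexSAWArmchairWallBridges.lean`; sibling of `HexSAWRotSurfaceYcLimitAllY.lean`).

Sources.  N. R. Beaton, *The critical surface fugacity of self-avoiding walks on a rotated honeycomb lattice*, J. Phys. A 47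
(2014) 075003 (arXiv:1210.0274v3): §3.1, Proposition 7 (arXiv v3 p. 11: `μ(y) = μ` for `y ≤ y_c`), its proof (pp. 12–14: the
fixed-length unfolding, "C^+_n(y) ≤ 4(1+1/y²) e^{c√m_n} U^+_{m_n}(y)") and the last paragraph of §3.1 (p. 14: "the mean density of
vertices in the surface … is `0` for `y < y_c`").  J. M. Hammersley, G. M. Torrie, S. G. Whittington, *Self-avoiding walks interacting
with a surface*, J. Phys. A 15 (1982) 539–571, §2 (bridges from the surface are half-space walks with one surface vertex; unfolding).
J. M. Hammersley, D. J. A. Welsh, Quart. J. Math. Oxford 13 (1962) 108–110 (`c_n ≤ e^{O(√n)} μ^n`); N. Madras, G. Slade, *The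
Self-Avoiding Walk* (1993), §3.1, Corollary 3.1.6, (3.1.9) (p. 61) (`b_n ≥ e^{-O(√n)} μ^n`).

What is in print is the LIMIT statement (density `→ y ∂log μ(y)/∂y = 0` for `y < y_c`) and, in the tree, its junk-free finite-`n`
form `tendsto_rotSurfDensity_zero` proved from EVENTUAL growth rates (`∃ ρ < μ`, `∀ᶠ n`), hence with no rate.  This file makes
every constant explicit, using only finite-`n` certified inequalities already in the tree — the Hammersley–Welsh bound
`c_m ≤ μ e^{6√m} μ^m` (`HexBW.hexSawCount_le_mu_mul_exp_mul_pow`), the bridge lower envelope behind it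
(`HexBW.hexSawCount_le_exp_mul_bridgeCount : c_n ≤ e^{6√n} b_{n+1}`, `hexConnectiveConstant_pow_le : μ^n ≤ c_n`) and the
explicit multiplicity of Beaton's unfolding (`HexBW.Arm.Aw_le_pow`):

* **`HexBW.Arm.bridges_subset_hp`, `HexBW.Arm.mul_bridgeCount_le_Cw : y · b_n ≤ C^w_n(y)`** — an `X`-bridge of the brick
  wall is a half-plane walk from the wall visiting it exactly once (Hammersley–Torrie–Whittington's remark, in Beaton's frame);
* **`HexBW.exp_mul_pow_le_mu_mul_bridgeCount : e^{-6√n} μ^n ≤ μ · b_n`** for EVERY `n`, and the pointwise LOWER envelope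
  **`HexBW.Arm.lower_envelope_Cw : (y/μ) e^{-6√n} μ^n ≤ C^w_n(y)`** (`y ≥ 0`), i.e.
  **`HV.rotHpCoeff_succ_ge : (y/μ) e^{-6√n} μ^n ≤ C⁺_{n+1}(y)`**;
* the pointwise UPPER envelope up to AND INCLUDING the critical fugacity: for `0 < y ≤ y† = rotYdagger`,
  **`HexBW.Arm.Cw_le_envelope : C^w_n(y) ≤ (n+1) μ e^{6√n} Ψ_n(y) μ^n`**, `Ψ_n(y) = HexBW.Arm.archEnv y n =
  (1638 · max(1,1/y)² · μ · (⌊√n⌋+1)²)^{58(⌊√n⌋+1)} = e^{O(√n log n)}` (`armRate_le_of_le_rotYdagger : β_rot(y) ≤ μ`), i.e.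
  **`HV.rotHpCoeff_succ_le`**; in particular the two-sided envelope AT criticality **`HV.rotHpCoeff_succ_critical_envelope :
  (y†/μ) e^{-6√n} μ^n ≤ C⁺_{n+1}(y†) ≤ (n+1) μ e^{6√n} Ψ_n(y†) μ^n`** — `log C⁺_{n+1}(y†) = n log μ + O(√n log n)` with
  explicit constants;
* the explicit ratio and tail bounds for `0 < y ≤ y†`: **`HV.rotHpCoeff_succ_ratio_le : C⁺_{n+1}(y†)/C⁺_{n+1}(y) ≤ rotEnv n / y`**,
  `rotEnv n = (n+1) μ² e^{12√n} Ψ_n(y†)`, and **`HV.rotSurfTail_succ_div_le`: the Boltzmann probability of `≥ t` surface vertices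
  is `≤ (y/y†)^t · rotEnv n / y`** for every `n` and `t`;
* **`HV.rotSurfMean_succ_le` — for `0 < y < y†` and EVERY `n`, the mean number of surface vertices of an `(n+1)`-vertex walk is
  `Σ_m m c⁺(m) y^m / C⁺(y) ≤ 2 + log((n+1) rotEnv n / y) / log(y†/y)`** (`= O_y(√n log n)`), and the explicit density rate
  **`HV.rotSurfDensity_succ_le : rotSurfDensity (n+1) y ≤ (2 + log((n+1) rotEnv n / y)/log(y†/y)) / (n+1)`** — an explicit
  rate for the tree's `tendsto_rotSurfDensity_zero`;
* `HV.rotYdagger_lt_three : y† < 3` (so that the logarithm above is positive: `HV.one_lt_rotEnv_div`);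
* the envelope in closed form: **`HV.log_rotEnv_le : log rotEnv n ≤ 834 (⌊√n⌋+1) log(⌊√n⌋+2)`**, whence
  **`HV.rotSurfMean_succ_le_closed : Σ_m m c⁺_{n+1}(m) y^m / C⁺_{n+1}(y) ≤ 2 + (836 (⌊√n⌋+1) log(⌊√n⌋+2) − log y)/log(y†/y)`**
  and **`HV.rotSurfDensity_succ_le_closed`** (the same divided by `n+1`) for `0 < y < y†` — numbers, not a rate symbol
  (`μ ≤ 2`, `log 1638 ≤ 11 log 2`, `12√n ≤ 18 (⌊√n⌋+1) log 2`).

NOT decided here: anything at `y > y†`, and the behaviour of the density AT `y = y†` (whether `E[m]/n → 0` at the critical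
fugacity is the continuity of the adsorption transition, not in print for this model).
Label: NEW-IN-WRITING (modest) — explicit finite-size constants for a printed qualitative statement, by the printed mechanisms
(bridges ⊆ half-plane walks, Hammersley–Welsh, Beaton's unfolding multiplicity).  Lane «pcv-sawmu», seat a-idea-1 g24 (lens:
bridge decompositions with explicit rates).  Pure standard axioms.
-/

noncomputable section

open Finset Filter Topology Literature.Probability.LatticeModels
open scoped BigOperators

namespace Literature.Probability.RandomPlanarGeometry.SAW

/-! ### `X`-bridges are half-plane walks from the wall with one wall vertex; the lower envelope -/

namespace HexBW

/-- **`e^{-6√n} μⁿ ≤ μ · b_n(ℍ)` for every `n`** (from `μ^{n-1} ≤ c_{n-1} ≤ e^{6√(n-1)} b_n`).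
[cite: MadrasSlade1993, §3.1, Corollary 3.1.6, (3.1.9) (p. 61) (b_n ≥ e^{-O(√n)} μ^n); HammersleyWelsh1962] -/
theorem exp_mul_pow_le_mu_mul_bridgeCount (n : ℕ) :
    Real.exp (-(6 * Real.sqrt n)) * hexConnectiveConstant ^ n ≤ hexConnectiveConstant * bridgeCount n := by
  have hμ1 : (1 : ℝ) ≤ hexConnectiveConstant := one_le_hexConnectiveConstant
  have hμ0 : (0 : ℝ) ≤ hexConnectiveConstant := zero_le_one.trans hμ1
  rcases n with _ | k
  · have hb : (1 : ℝ) ≤ bridgeCount 0 := by exact_mod_cast one_le_bridgeCount 0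
    simp only [Nat.cast_zero, Real.sqrt_zero, mul_zero, neg_zero, Real.exp_zero, pow_zero, one_mul]
    nlinarith
  · have h1 : hexConnectiveConstant ^ k ≤ hexSawCount k := hexConnectiveConstant_pow_le k
    have h2 := hexSawCount_le_exp_mul_bridgeCount k
    have hb : (0 : ℝ) ≤ bridgeCount (k + 1) := Nat.cast_nonneg _
    have hs : Real.sqrt (k : ℝ) ≤ Real.sqrt ((k + 1 : ℕ) : ℝ) :=
      Real.sqrt_le_sqrt (by exact_mod_cast Nat.le_succ k)
    have hE : Real.exp (-(6 * Real.sqrt ((k + 1 : ℕ) : ℝ))) * Real.exp (6 * Real.sqrt k) ≤ 1 := by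
      rw [← Real.exp_add]
      exact Real.exp_le_one_iff.2 (by linarith)
    calc Real.exp (-(6 * Real.sqrt ((k + 1 : ℕ) : ℝ))) * hexConnectiveConstant ^ (k + 1)
        = hexConnectiveConstant * (Real.exp (-(6 * Real.sqrt ((k + 1 : ℕ) : ℝ))) * hexConnectiveConstant ^ k) := by ring
      _ ≤ hexConnectiveConstant * (Real.exp (-(6 * Real.sqrt ((k + 1 : ℕ) : ℝ))) *
            (Real.exp (6 * Real.sqrt k) * bridgeCount (k + 1))) := by
          gcongr
          exact h1.trans h2
      _ = hexConnectiveConstant * ((Real.exp (-(6 * Real.sqrt ((k + 1 : ℕ) : ℝ))) * Real.exp (6 * Real.sqrt k)) *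
            bridgeCount (k + 1)) := by ring
      _ ≤ hexConnectiveConstant * (1 * bridgeCount (k + 1)) := by gcongr
      _ = hexConnectiveConstant * bridgeCount (k + 1) := by ring

namespace Arm

variable {y : ℝ}

/-- An `X`-bridge of the brick wall visits the wall `X = 0` only at its start.
[cite: HammersleyTorrieWhittington1982, §2 (a bridge from the surface has one vertex in the surface)] -/
private theorem visits_eq_one_of_isBridge {n : ℕ} {ω : ℕ → Site 2} (h0 : ω 0 0 = 0) (hb : Zd.IsBridge n ω) :
    visits n ω = 1 := by
  have h := visits_add_eq_left (k := 0) (b := n) (ζ := ω) (fun j hj hjn => by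
    rw [Nat.zero_add]
    have h' := (hb j hj hjn).1
    rw [h0] at h'
    exact h'.ne')
  rw [Nat.zero_add] at h
  rw [h, visits_zero, if_pos h0]

/-- The start of a brick-wall walk is on the wall: `X_0 = 0`. [folklore] -/
private theorem apply_zero_zero_of_mem_saws {n : ℕ} {ω : ℕ → Site 2} (hs : ω ∈ saws n) : ω 0 0 = 0 := by
  rw [(Zd.mem_saws.1 (mem_saws.1 hs).1).1]; rfl

/-- **`X`-bridges are half-plane walks from the wall: `bridges n ⊆ hp n`** (`0 = X_0 < X_i`, `1 ≤ i ≤ n`).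
[cite: HammersleyTorrieWhittington1982, §2 (bridges from the surface lie in the half-space); Beaton2014RotatedHoneycomb, §3.1 (arXiv v3 p. 11: c^+_n(m))] -/
theorem bridges_subset_hp (n : ℕ) : bridges n ⊆ hp n := by
  intro ω hω
  rcases mem_bridges.1 hω with ⟨hs, hb⟩
  have h0 := apply_zero_zero_of_mem_saws hs
  refine mem_hp.2 ⟨hs, fun i hi => ?_⟩
  rcases Nat.eq_zero_or_pos i with rfl | hi0
  · rw [h0]
  · have h' := (hb i hi0 hi).1
    rw [h0] at h'
    exact h'.le

open Classical in
/-- **`y · b_n(ℍ) ≤ C^w_n(y)`** for `y ≥ 0`: each `X`-bridge contributes `y¹`.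
[cite: HammersleyTorrieWhittington1982, §2 (a bridge from the surface has one surface vertex); Beaton2014RotatedHoneycomb, §3.1 (arXiv v3 p. 11: C^+_n(y))] -/
theorem mul_bridgeCount_le_Cw (n : ℕ) (hy : 0 ≤ y) : y * bridgeCount n ≤ Cw n y := by
  have h1 : ∀ ω ∈ bridges n, y ^ visits n ω = y := fun ω hω => by
    rcases mem_bridges.1 hω with ⟨hs, hb⟩
    rw [visits_eq_one_of_isBridge (apply_zero_zero_of_mem_saws hs) hb, pow_one]
  calc y * bridgeCount n = ∑ ω ∈ bridges n, y ^ visits n ω := by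
        rw [Finset.sum_congr rfl h1, Finset.sum_const, nsmul_eq_mul, bridgeCount, mul_comm]
    _ ≤ Cw n y := Finset.sum_le_sum_of_subset_of_nonneg (bridges_subset_hp n) fun _ _ _ => pow_nonneg hy _

/-- **Lower envelope in product form: `y μⁿ ≤ μ e^{6√n} C^w_n(y)`** (`y ≥ 0`, every `n`).
[cite: HammersleyTorrieWhittington1982, §2; MadrasSlade1993, §3.1, Corollary 3.1.6] -/
theorem mul_pow_le_mul_exp_mul_Cw (n : ℕ) (hy : 0 ≤ y) :
    y * hexConnectiveConstant ^ n ≤ hexConnectiveConstant * Real.exp (6 * Real.sqrt n) * Cw n y := by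
  have h := exp_mul_pow_le_mu_mul_bridgeCount n
  have hC := mul_bridgeCount_le_Cw n hy
  have hμ0 : (0 : ℝ) ≤ hexConnectiveConstant := hexConnectiveConstant_pos.le
  have hE : Real.exp (6 * Real.sqrt n) * Real.exp (-(6 * Real.sqrt n)) = 1 := by
    rw [← Real.exp_add, add_neg_cancel, Real.exp_zero]
  calc y * hexConnectiveConstant ^ n
      = Real.exp (6 * Real.sqrt n) * (Real.exp (-(6 * Real.sqrt n)) * hexConnectiveConstant ^ n) * y := by
        rw [← mul_assoc, hE, one_mul, mul_comm]
    _ ≤ Real.exp (6 * Real.sqrt n) * (hexConnectiveConstant * bridgeCount n) * y := by gcongr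
    _ = hexConnectiveConstant * Real.exp (6 * Real.sqrt n) * (y * bridgeCount n) := by ring
    _ ≤ hexConnectiveConstant * Real.exp (6 * Real.sqrt n) * Cw n y := by gcongr

/-- **Lower envelope: `(y/μ) e^{-6√n} μⁿ ≤ C^w_n(y)`** (`y ≥ 0`, every `n`).
[cite: HammersleyTorrieWhittington1982, §2; MadrasSlade1993, §3.1, Corollary 3.1.6] -/
theorem lower_envelope_Cw (n : ℕ) (hy : 0 ≤ y) :
    y / hexConnectiveConstant * Real.exp (-(6 * Real.sqrt n)) * hexConnectiveConstant ^ n ≤ Cw n y := by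
  have hμ := hexConnectiveConstant_pos
  have h := exp_mul_pow_le_mu_mul_bridgeCount n
  calc y / hexConnectiveConstant * Real.exp (-(6 * Real.sqrt n)) * hexConnectiveConstant ^ n
      = y / hexConnectiveConstant * (Real.exp (-(6 * Real.sqrt n)) * hexConnectiveConstant ^ n) := by ring
    _ ≤ y / hexConnectiveConstant * (hexConnectiveConstant * bridgeCount n) := by gcongr
    _ = y * bridgeCount n := by field_simp
    _ ≤ Cw n y := mul_bridgeCount_le_Cw n hy

/-! ### The upper envelope up to the critical fugacity -/

/-- **`Ψ_n(y) = (1638 · max(1,1/y)² · μ · (⌊√n⌋+1)²)^{58(⌊√n⌋+1)}`** — Beaton's unfolding multiplicity `HexBW.Arm.Aw_le_pow` with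
`max(1, β_rot(y))` replaced by `μ` (valid for `y ≤ y†`); `log Ψ_n(y) = O(√n log n)`.
[cite: Beaton2014RotatedHoneycomb, §3.1, proof of Proposition 7 (arXiv v3 pp. 13–14, (18)–(19); (19), top of p. 14: "C^+_n(y) ≤ 4(1+1/y²) e^{c√m_n} U^+_{m_n}(y)")] -/
def archEnv (y : ℝ) (n : ℕ) : ℝ :=
  (1638 * max 1 y⁻¹ ^ 2 * hexConnectiveConstant * ((Nat.sqrt n : ℝ) + 1) ^ 2) ^ (58 * (Nat.sqrt n + 1))

/-- The base of `Ψ_n(y)` is `≥ 1638`. [cite: Beaton2014RotatedHoneycomb, §3.1, proof of Proposition 7 (arXiv v3 pp. 13–14, (18)–(19))] -/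
private theorem base_ge (y : ℝ) (n : ℕ) :
    (1638 : ℝ) ≤ 1638 * max 1 y⁻¹ ^ 2 * hexConnectiveConstant * ((Nat.sqrt n : ℝ) + 1) ^ 2 := by
  have h1 : (1 : ℝ) ≤ max 1 y⁻¹ ^ 2 := one_le_pow₀ (le_max_left _ _)
  have h2 : (1 : ℝ) ≤ ((Nat.sqrt n : ℝ) + 1) ^ 2 :=
    one_le_pow₀ (by have := (Nat.cast_nonneg (Nat.sqrt n) : (0 : ℝ) ≤ _); linarith)
  have h3 : (1 : ℝ) ≤ hexConnectiveConstant := one_le_hexConnectiveConstant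
  calc (1638 : ℝ) = 1638 * 1 * 1 * 1 := by ring
    _ ≤ 1638 * max 1 y⁻¹ ^ 2 * hexConnectiveConstant * ((Nat.sqrt n : ℝ) + 1) ^ 2 := by gcongr

/-- **`1638 ≤ Ψ_n(y)`** (in particular `Ψ_n(y) ≥ 1`). [cite: Beaton2014RotatedHoneycomb, §3.1, proof of Proposition 7 (arXiv v3 pp. 13–14, (18)–(19))] -/
theorem le_archEnv (y : ℝ) (n : ℕ) : (1638 : ℝ) ≤ archEnv y n := by
  have hb := base_ge y n
  calc (1638 : ℝ) ≤ 1638 * max 1 y⁻¹ ^ 2 * hexConnectiveConstant * ((Nat.sqrt n : ℝ) + 1) ^ 2 := hb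
    _ ≤ archEnv y n := le_self_pow₀ (le_trans (by norm_num) hb) (by omega)

/-- `0 < Ψ_n(y)`. [cite: Beaton2014RotatedHoneycomb, §3.1, proof of Proposition 7 (arXiv v3 pp. 13–14, (18)–(19))] -/
theorem archEnv_pos (y : ℝ) (n : ℕ) : 0 < archEnv y n := lt_of_lt_of_le (by norm_num) (le_archEnv y n)

/-- `Ψ` is monotone in `n`. [cite: Beaton2014RotatedHoneycomb, §3.1, proof of Proposition 7 (arXiv v3 pp. 13–14, (18)–(19))] -/
theorem archEnv_mono (y : ℝ) {k n : ℕ} (hkn : k ≤ n) : archEnv y k ≤ archEnv y n := by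
  have hbk := base_ge y k
  have hbn := base_ge y n
  have hs : (Nat.sqrt k : ℝ) ≤ Nat.sqrt n := by exact_mod_cast Nat.sqrt_le_sqrt hkn
  have h0 : (0 : ℝ) ≤ (Nat.sqrt k : ℝ) + 1 := by positivity
  have hc : (0 : ℝ) ≤ 1638 * max 1 y⁻¹ ^ 2 * hexConnectiveConstant :=
    mul_nonneg (mul_nonneg (by norm_num) (pow_nonneg (zero_le_one.trans (le_max_left _ _)) _))
      hexConnectiveConstant_pos.le
  have hB : 1638 * max 1 y⁻¹ ^ 2 * hexConnectiveConstant * ((Nat.sqrt k : ℝ) + 1) ^ 2 ≤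
      1638 * max 1 y⁻¹ ^ 2 * hexConnectiveConstant * ((Nat.sqrt n : ℝ) + 1) ^ 2 :=
    mul_le_mul_of_nonneg_left (pow_le_pow_left₀ h0 (by linarith) 2) hc
  unfold archEnv
  calc (1638 * max 1 y⁻¹ ^ 2 * hexConnectiveConstant * ((Nat.sqrt k : ℝ) + 1) ^ 2) ^ (58 * (Nat.sqrt k + 1))
      ≤ (1638 * max 1 y⁻¹ ^ 2 * hexConnectiveConstant * ((Nat.sqrt n : ℝ) + 1) ^ 2) ^ (58 * (Nat.sqrt k + 1)) :=
        pow_le_pow_left₀ (le_trans (by norm_num) hbk) hB _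
    _ ≤ (1638 * max 1 y⁻¹ ^ 2 * hexConnectiveConstant * ((Nat.sqrt n : ℝ) + 1) ^ 2) ^ (58 * (Nat.sqrt n + 1)) :=
        pow_le_pow_right₀ (le_trans (by norm_num) hbn)
          (Nat.mul_le_mul_left _ (Nat.succ_le_succ (Nat.sqrt_le_sqrt hkn)))

/-- **`β_rot(y) ≤ μ` for `0 < y ≤ y†`** (Beaton's Proposition 7 below and at the critical fugacity, rate form).
[cite: Beaton2014RotatedHoneycomb, Proposition 7 (arXiv v3 p. 11: μ(y) = μ for y ≤ y_c)] -/
theorem armRate_le_of_le_rotYdagger (hy : 0 < y) (h : y ≤ HV.rotYdagger) : armRate y ≤ hexConnectiveConstant :=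
  not_lt.1 fun hlt => (not_lt.2 h) ((HV.hexConnectiveConstant_lt_armRate_iff_of_archBound hy (archBound_holds hy)).1 hlt)

/-- **`A_k(y) ≤ Ψ_n(y) μ^k`** for `k ≤ n` and `0 < y ≤ y†`.
[cite: Beaton2014RotatedHoneycomb, §3.1, proof of Proposition 7 (arXiv v3 pp. 12–13: fixed-length unfolding)] -/
theorem Aw_le_archEnv_mul_pow (hy : 0 < y) (h : y ≤ HV.rotYdagger) {k n : ℕ} (hkn : k ≤ n) :
    Aw k y ≤ archEnv y n * hexConnectiveConstant ^ k := by
  have hβμ := armRate_le_of_le_rotYdagger hy h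
  have hβ0 : 0 ≤ armRate y := (armRate_pos y).le
  have hμ1 : (1 : ℝ) ≤ hexConnectiveConstant := one_le_hexConnectiveConstant
  have hμ0 : (0 : ℝ) ≤ hexConnectiveConstant := zero_le_one.trans hμ1
  have hmax : max 1 (armRate y) ≤ hexConnectiveConstant := max_le hμ1 hβμ
  calc Aw k y ≤ (1638 * max 1 y⁻¹ ^ 2 * max 1 (armRate y) * ((Nat.sqrt k : ℝ) + 1) ^ 2) ^ (58 * (Nat.sqrt k + 1)) *
        armRate y ^ k := Aw_le_pow hy k
    _ ≤ (1638 * max 1 y⁻¹ ^ 2 * hexConnectiveConstant * ((Nat.sqrt k : ℝ) + 1) ^ 2) ^ (58 * (Nat.sqrt k + 1)) *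
        hexConnectiveConstant ^ k := by gcongr
    _ = archEnv y k * hexConnectiveConstant ^ k := rfl
    _ ≤ archEnv y n * hexConnectiveConstant ^ k :=
        mul_le_mul_of_nonneg_right (archEnv_mono y hkn) (pow_nonneg hμ0 _)

open Classical in
/-- **Upper envelope up to the critical fugacity: `C^w_n(y) ≤ (n+1) μ e^{6√n} Ψ_n(y) μⁿ`** for `0 < y ≤ y†` and every `n`
(split at the last wall visit, the unfolding bound on the arch, Hammersley–Welsh on the free tail).
[cite: Beaton2014RotatedHoneycomb, §3.1, proof of Proposition 7 (arXiv v3 pp. 12–14); HammersleyWelsh1962] -/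
theorem Cw_le_envelope (hy : 0 < y) (h : y ≤ HV.rotYdagger) (n : ℕ) :
    Cw n y ≤ (n + 1) * hexConnectiveConstant * Real.exp (6 * Real.sqrt n) * archEnv y n * hexConnectiveConstant ^ n := by
  have hμ0 : (0 : ℝ) ≤ hexConnectiveConstant := hexConnectiveConstant_pos.le
  have hA0 : 0 ≤ archEnv y n := (archEnv_pos y n).le
  have hterm : ∀ k ∈ range (n + 1), Aw k y * (#(saws (n - k)) : ℝ) ≤
      archEnv y n * hexConnectiveConstant ^ n * (hexConnectiveConstant * Real.exp (6 * Real.sqrt n)) := by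
    intro k hk
    have hkn : k ≤ n := Nat.le_of_lt_succ (mem_range.1 hk)
    have h1 := Aw_le_archEnv_mul_pow hy h hkn
    have h2 : (#(saws (n - k)) : ℝ) ≤ hexConnectiveConstant * Real.exp (6 * Real.sqrt ((n - k : ℕ) : ℝ)) *
        hexConnectiveConstant ^ (n - k) := by
      rw [card_saws]; exact hexSawCount_le_mu_mul_exp_mul_pow (n - k)
    have h3 : Real.exp (6 * Real.sqrt ((n - k : ℕ) : ℝ)) ≤ Real.exp (6 * Real.sqrt n) := by
      apply Real.exp_le_exp.2
      gcongr
      exact_mod_cast Nat.sub_le n k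
    have hpow : hexConnectiveConstant ^ n = hexConnectiveConstant ^ k * hexConnectiveConstant ^ (n - k) := by
      rw [← pow_add, Nat.add_sub_cancel' hkn]
    calc Aw k y * (#(saws (n - k)) : ℝ)
        ≤ (archEnv y n * hexConnectiveConstant ^ k) * (hexConnectiveConstant *
            Real.exp (6 * Real.sqrt ((n - k : ℕ) : ℝ)) * hexConnectiveConstant ^ (n - k)) :=
          mul_le_mul h1 h2 (Nat.cast_nonneg _) (mul_nonneg hA0 (pow_nonneg hμ0 _))
      _ = archEnv y n * hexConnectiveConstant ^ n * (hexConnectiveConstant *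
            Real.exp (6 * Real.sqrt ((n - k : ℕ) : ℝ))) := by rw [hpow]; ring
      _ ≤ archEnv y n * hexConnectiveConstant ^ n * (hexConnectiveConstant * Real.exp (6 * Real.sqrt n)) :=
          mul_le_mul_of_nonneg_left (mul_le_mul_of_nonneg_left h3 hμ0) (mul_nonneg hA0 (pow_nonneg hμ0 _))
  calc Cw n y ≤ ∑ k ∈ range (n + 1), Aw k y * (#(saws (n - k)) : ℝ) := Cw_le_sum n hy.le
    _ ≤ ∑ k ∈ range (n + 1), archEnv y n * hexConnectiveConstant ^ n *
          (hexConnectiveConstant * Real.exp (6 * Real.sqrt n)) := sum_le_sum hterm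
    _ = (n + 1) * hexConnectiveConstant * Real.exp (6 * Real.sqrt n) * archEnv y n * hexConnectiveConstant ^ n := by
        rw [sum_const, card_range, nsmul_eq_mul]; push_cast; ring

end Arm

end HexBW

/-! ### Beaton's frame: explicit envelopes for `C⁺_{n+1}(y)`, the ratio, the tail, the mean and the density -/

namespace HV

open HexBW HexBW.Arm

variable {y : ℝ}

/-- `cos(5π/16) > 1/2` (`5π/16 < π/3`). [folklore] -/
private theorem half_lt_cos_five_pi_div_sixteen : 1 / 2 < Real.cos (5 * Real.pi / 16) := by
  have h := Real.cos_lt_cos_of_nonneg_of_le_pi_div_two (x := 5 * Real.pi / 16) (y := Real.pi / 3)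
    (by linarith [Real.pi_pos]) (by linarith [Real.pi_pos]) (by linarith [Real.pi_pos])
  rwa [Real.cos_pi_div_three] at h

/-- `(x_c y†)² ≤ 2`. [cite: Beaton2014RotatedHoneycomb, §4 (arXiv v3 p. 16: y†)] -/
private theorem sq_hexCriticalFugacity_mul_rotYdagger_le_two : (hexCriticalFugacity * rotYdagger) ^ 2 ≤ 2 := by
  have hc5 := half_lt_cos_five_pi_div_sixteen
  have hc1 : Real.cos (Real.pi / 16) ≤ 1 := Real.cos_le_one _
  rw [sq_hexCriticalFugacity_mul_rotYdagger, div_le_iff₀ (by linarith)]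
  linarith

/-- `y†² ≤ 2 (2 + √2)` (`x_c⁻² = 2 + √2`). [cite: Beaton2014RotatedHoneycomb, §4 (arXiv v3 p. 16: y† = √((2+√2)/(1+√2-√(2+√2))))] -/
private theorem rotYdagger_sq_le : rotYdagger ^ 2 ≤ 2 * (2 + Real.sqrt 2) := by
  have hx0 : 0 < hexCriticalFugacity := hexCriticalFugacity_pos_lt_one.1
  have hx2 : 0 < hexCriticalFugacity ^ 2 := by positivity
  have e1 : hexCriticalFugacity ^ 2 * rotYdagger ^ 2 ≤ 2 := by
    rw [← mul_pow]; exact sq_hexCriticalFugacity_mul_rotYdagger_le_two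
  have e2 : hexCriticalFugacity ^ 2 * (2 * (2 + Real.sqrt 2)) = 2 := by
    linear_combination 2 * hexCriticalFugacity_sq
  exact le_of_mul_le_mul_left (e2.symm ▸ e1) hx2

/-- **`y† < 3`** (`(x_c y†)² = cos(π/16)/cos(5π/16) ≤ 2` and `x_c⁻² = 2 + √2`; in print `y† = 2.455…`).
[cite: Beaton2014RotatedHoneycomb, Theorem 1 (arXiv v3 p. 2: y_c = 2.455…), §4 (p. 16: y†)] -/
theorem rotYdagger_lt_three : rotYdagger < 3 := by
  have h := rotYdagger_sq_le
  have hyd := rotYdagger_pos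
  have h2 : Real.sqrt 2 < 3 / 2 := by
    rw [show (3 / 2 : ℝ) = Real.sqrt ((3 / 2) ^ 2) by rw [Real.sqrt_sq (by norm_num)]]
    exact Real.sqrt_lt_sqrt (by norm_num) (by norm_num)
  nlinarith

/-- **`rotEnv n = (n+1) μ² e^{12√n} Ψ_n(y†)`** — the explicit envelope of the ratio `y · C⁺_{n+1}(y†)/C⁺_{n+1}(y)`, `0 < y ≤ y†`;
`log rotEnv n = O(√n log n)`. [cite: Beaton2014RotatedHoneycomb, §3.1, proof of Proposition 7 (arXiv v3 pp. 12–14)] -/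
def rotEnv (n : ℕ) : ℝ :=
  (n + 1) * hexConnectiveConstant ^ 2 * Real.exp (12 * Real.sqrt n) * archEnv rotYdagger n

/-- `1638 ≤ rotEnv n`. [cite: Beaton2014RotatedHoneycomb, §3.1, proof of Proposition 7 (arXiv v3 pp. 13–14, (18)–(19))] -/
theorem le_rotEnv (n : ℕ) : (1638 : ℝ) ≤ rotEnv n := by
  have h1 : (1 : ℝ) ≤ (n : ℝ) + 1 := by have := (Nat.cast_nonneg n : (0 : ℝ) ≤ n); linarith
  have h2 : (1 : ℝ) ≤ hexConnectiveConstant ^ 2 := one_le_pow₀ one_le_hexConnectiveConstant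
  have h3 : (1 : ℝ) ≤ Real.exp (12 * Real.sqrt n) := Real.one_le_exp (by positivity)
  have h4 := le_archEnv rotYdagger n
  calc (1638 : ℝ) = 1 * 1 * 1 * 1638 := by ring
    _ ≤ rotEnv n := by unfold rotEnv; gcongr

/-- `0 < rotEnv n`. [cite: Beaton2014RotatedHoneycomb, §3.1, proof of Proposition 7 (arXiv v3 pp. 13–14, (18)–(19))] -/
theorem rotEnv_pos (n : ℕ) : 0 < rotEnv n := lt_of_lt_of_le (by norm_num) (le_rotEnv n)

/-- **Lower envelope: `(y/μ) e^{-6√n} μⁿ ≤ C⁺_{n+1}(y)`** for `y ≥ 0` and every `n` (`X`-bridges are rotated half-plane walks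
with one surface vertex). [cite: HammersleyTorrieWhittington1982, §2; MadrasSlade1993, §3.1, Corollary 3.1.6; Beaton2014RotatedHoneycomb, §3.1 (arXiv v3 p. 11: C^+_n(y))] -/
theorem rotHpCoeff_succ_ge (n : ℕ) (hy : 0 ≤ y) :
    y / hexConnectiveConstant * Real.exp (-(6 * Real.sqrt n)) * hexConnectiveConstant ^ n ≤ rotHpCoeff (n + 1) y := by
  rw [rotHpCoeff_succ_eq]; exact lower_envelope_Cw n hy

/-- Lower envelope, product form: `y μⁿ ≤ μ e^{6√n} C⁺_{n+1}(y)` (`y ≥ 0`).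
[cite: HammersleyTorrieWhittington1982, §2; MadrasSlade1993, §3.1, Corollary 3.1.6] -/
theorem mul_pow_le_mul_exp_mul_rotHpCoeff_succ (n : ℕ) (hy : 0 ≤ y) :
    y * hexConnectiveConstant ^ n ≤ hexConnectiveConstant * Real.exp (6 * Real.sqrt n) * rotHpCoeff (n + 1) y := by
  rw [rotHpCoeff_succ_eq]; exact mul_pow_le_mul_exp_mul_Cw n hy

/-- `0 < C⁺_{n+1}(y)` for `y > 0`. [cite: Beaton2014RotatedHoneycomb, §3.1 (arXiv v3 p. 11: C^+_n(y))] -/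
theorem rotHpCoeff_succ_pos (n : ℕ) (hy : 0 < y) : 0 < rotHpCoeff (n + 1) y := by
  have hμ := hexConnectiveConstant_pos
  exact lt_of_lt_of_le (by positivity) (rotHpCoeff_succ_ge n hy.le)

/-- **Upper envelope up to and including the critical fugacity: `C⁺_{n+1}(y) ≤ (n+1) μ e^{6√n} Ψ_n(y) μⁿ`** for
`0 < y ≤ y†` and every `n`. [cite: Beaton2014RotatedHoneycomb, §3.1, Proposition 7 and its proof (arXiv v3 pp. 11–14); HammersleyWelsh1962] -/
theorem rotHpCoeff_succ_le (hy : 0 < y) (h : y ≤ rotYdagger) (n : ℕ) :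
    rotHpCoeff (n + 1) y ≤
      (n + 1) * hexConnectiveConstant * Real.exp (6 * Real.sqrt n) * archEnv y n * hexConnectiveConstant ^ n := by
  rw [rotHpCoeff_succ_eq]; exact Cw_le_envelope hy h n

/-- **Two-sided explicit envelope AT the critical fugacity: `(y†/μ) e^{-6√n} μⁿ ≤ C⁺_{n+1}(y†) ≤ (n+1) μ e^{6√n} Ψ_n(y†) μⁿ`**
— `log C⁺_{n+1}(y†) = n log μ + O(√n log n)` with explicit constants.
[cite: Beaton2014RotatedHoneycomb, Proposition 7 (arXiv v3 p. 11: μ(y_c) = μ), its proof (pp. 12–14)] -/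
theorem rotHpCoeff_succ_critical_envelope (n : ℕ) :
    rotYdagger / hexConnectiveConstant * Real.exp (-(6 * Real.sqrt n)) * hexConnectiveConstant ^ n ≤
        rotHpCoeff (n + 1) rotYdagger ∧
      rotHpCoeff (n + 1) rotYdagger ≤ (n + 1) * hexConnectiveConstant * Real.exp (6 * Real.sqrt n) *
        archEnv rotYdagger n * hexConnectiveConstant ^ n :=
  ⟨rotHpCoeff_succ_ge n rotYdagger_pos.le, rotHpCoeff_succ_le rotYdagger_pos le_rfl n⟩

/-- **Explicit ratio bound: `C⁺_{n+1}(y†) / C⁺_{n+1}(y) ≤ rotEnv n / y`** for `y > 0` and every `n` (of interest for `y ≤ y†`).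
[cite: Beaton2014RotatedHoneycomb, §3.1, Proposition 7 and its proof (arXiv v3 pp. 11–14)] -/
theorem rotHpCoeff_succ_ratio_le (hy : 0 < y) (n : ℕ) :
    rotHpCoeff (n + 1) rotYdagger / rotHpCoeff (n + 1) y ≤ rotEnv n / y := by
  have hC := rotHpCoeff_succ_pos n hy
  have hup := rotHpCoeff_succ_le rotYdagger_pos le_rfl n
  have hlo := mul_pow_le_mul_exp_mul_rotHpCoeff_succ n hy.le
  have hA0 : 0 ≤ archEnv rotYdagger n := (archEnv_pos rotYdagger n).le
  have hμ0 : (0 : ℝ) ≤ hexConnectiveConstant := hexConnectiveConstant_pos.le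
  have hE : Real.exp (12 * Real.sqrt n) = Real.exp (6 * Real.sqrt n) * Real.exp (6 * Real.sqrt n) := by
    rw [← Real.exp_add]; ring_nf
  rw [div_le_iff₀ hC, div_mul_eq_mul_div, le_div_iff₀ hy]
  calc rotHpCoeff (n + 1) rotYdagger * y
      ≤ ((n + 1) * hexConnectiveConstant * Real.exp (6 * Real.sqrt n) * archEnv rotYdagger n *
          hexConnectiveConstant ^ n) * y := by gcongr
    _ = (n + 1) * hexConnectiveConstant * Real.exp (6 * Real.sqrt n) * archEnv rotYdagger n *
          (y * hexConnectiveConstant ^ n) := by ring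
    _ ≤ (n + 1) * hexConnectiveConstant * Real.exp (6 * Real.sqrt n) * archEnv rotYdagger n *
          (hexConnectiveConstant * Real.exp (6 * Real.sqrt n) * rotHpCoeff (n + 1) y) := by gcongr
    _ = rotEnv n * rotHpCoeff (n + 1) y := by rw [rotEnv, hE]; ring

/-- **Explicit tail bound: the Boltzmann probability of at least `t` surface vertices is `≤ (y/y†)^t · rotEnv n / y`**,
`0 < y ≤ y†`, every `n` and `t`. [cite: Beaton2014RotatedHoneycomb, §3.1, last paragraph (arXiv v3 p. 14: "the density of vertices in the surface is 0 for y < y_c")] -/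
theorem rotSurfTail_succ_div_le (hy : 0 < y) (h : y ≤ rotYdagger) (n t : ℕ) :
    rotSurfTail (n + 1) t y / rotHpCoeff (n + 1) y ≤ (y / rotYdagger) ^ t * (rotEnv n / y) := by
  have hC := rotHpCoeff_succ_pos n hy
  have hq : 0 ≤ (y / rotYdagger) ^ t := pow_nonneg (div_nonneg hy.le rotYdagger_pos.le) _
  calc rotSurfTail (n + 1) t y / rotHpCoeff (n + 1) y
      ≤ (y / rotYdagger) ^ t * rotHpCoeff (n + 1) rotYdagger / rotHpCoeff (n + 1) y := by
        gcongr; exact rotSurfTail_le_pow_mul hy h (n + 1) t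
    _ = (y / rotYdagger) ^ t * (rotHpCoeff (n + 1) rotYdagger / rotHpCoeff (n + 1) y) := mul_div_assoc _ _ _
    _ ≤ (y / rotYdagger) ^ t * (rotEnv n / y) :=
        mul_le_mul_of_nonneg_left (rotHpCoeff_succ_ratio_le hy n) hq

/-- **Markov splitting with the explicit tail**: for `0 < y ≤ y†` and every `n`, `t`, the mean number of surface vertices
`Σ_m m c⁺_{n+1}(m) y^m / C⁺_{n+1}(y) ≤ t + (n+1) (y/y†)^t rotEnv n / y`.
[cite: Beaton2014RotatedHoneycomb, §3.1, last paragraph (arXiv v3 p. 14: "the mean density of vertices in the surface")] -/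
theorem rotSurfMean_succ_le_of_tail (hy : 0 < y) (h : y ≤ rotYdagger) (n t : ℕ) :
    rotSurfMoment (n + 1) y / rotHpCoeff (n + 1) y ≤ t + (n + 1) * ((y / rotYdagger) ^ t * (rotEnv n / y)) := by
  have hC := rotHpCoeff_succ_pos n hy
  have h1 := rotSurfMoment_le_add (n + 1) t hy.le
  have h2 : rotSurfTail (n + 1) t y ≤ (y / rotYdagger) ^ t * (rotEnv n / y) * rotHpCoeff (n + 1) y :=
    (div_le_iff₀ hC).1 (rotSurfTail_succ_div_le hy h n t)
  rw [div_le_iff₀ hC]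
  calc rotSurfMoment (n + 1) y ≤ t * rotHpCoeff (n + 1) y + ((n + 1 : ℕ) : ℝ) * rotSurfTail (n + 1) t y := h1
    _ ≤ t * rotHpCoeff (n + 1) y + ((n + 1 : ℕ) : ℝ) *
          ((y / rotYdagger) ^ t * (rotEnv n / y) * rotHpCoeff (n + 1) y) := by gcongr
    _ = (t + (n + 1) * ((y / rotYdagger) ^ t * (rotEnv n / y))) * rotHpCoeff (n + 1) y := by push_cast; ring

/-- `1 < (n+1) rotEnv n / y` for `0 < y ≤ y†` (as `y† < 3 ≤ 1638 ≤ rotEnv n`).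
[cite: Beaton2014RotatedHoneycomb, Theorem 1 (arXiv v3 p. 2: y_c = 2.455…)] -/
theorem one_lt_rotEnv_div (hy : 0 < y) (h : y ≤ rotYdagger) (n : ℕ) : 1 < (n + 1) * rotEnv n / y := by
  have h3 := rotYdagger_lt_three
  have hE := le_rotEnv n
  have hn : (1 : ℝ) ≤ (n : ℝ) + 1 := by have := (Nat.cast_nonneg n : (0 : ℝ) ≤ n); linarith
  rw [lt_div_iff₀ hy, one_mul]
  calc y < 3 := lt_of_le_of_lt h h3
    _ ≤ 1 * 1638 := by norm_num
    _ ≤ (n + 1) * rotEnv n := by gcongr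

/-- **The mean number of surface vertices below the critical fugacity is `O(√n log n)`, explicitly**: for `0 < y < y†` and
EVERY `n`, `Σ_m m c⁺_{n+1}(m) y^m / C⁺_{n+1}(y) ≤ 2 + log((n+1) rotEnv n / y) / log(y†/y)`, where
`log rotEnv n = log(n+1) + 2 log μ + 12√n + 58(⌊√n⌋+1) log(1638 μ (⌊√n⌋+1)²)`.
[cite: Beaton2014RotatedHoneycomb, §3.1, last paragraph (arXiv v3 p. 14: "the density of vertices in the surface is 0 for y < y_c"); HammersleyTorrieWhittington1982, §2] -/
theorem rotSurfMean_succ_le (hy : 0 < y) (h : y < rotYdagger) (n : ℕ) :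
    rotSurfMoment (n + 1) y / rotHpCoeff (n + 1) y ≤
      2 + Real.log ((n + 1) * rotEnv n / y) / Real.log (rotYdagger / y) := by
  have hyd := rotYdagger_pos
  set A : ℝ := (n + 1) * rotEnv n / y with hA
  set q : ℝ := rotYdagger / y with hq
  have hA1 : 1 < A := one_lt_rotEnv_div hy h.le n
  have hA0 : 0 < A := one_pos.trans hA1
  have hq1 : 1 < q := (one_lt_div hy).2 h
  have hq0 : 0 < q := one_pos.trans hq1
  have hlogq : 0 < Real.log q := Real.log_pos hq1
  have hlogA : 0 ≤ Real.log A := Real.log_nonneg hA1.le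
  set τ : ℝ := Real.log A / Real.log q with hτ
  have hτ0 : 0 ≤ τ := div_nonneg hlogA hlogq.le
  set t : ℕ := ⌈τ⌉₊ with ht
  -- `q^t ≥ A`, i.e. `A (1/q)^t ≤ 1`.
  have hqt : A ≤ q ^ t := by
    have hle : Real.log A ≤ t * Real.log q := by
      calc Real.log A = τ * Real.log q := by rw [hτ, div_mul_cancel₀ _ hlogq.ne']
        _ ≤ t * Real.log q := mul_le_mul_of_nonneg_right (Nat.le_ceil τ) hlogq.le
    calc A = Real.exp (Real.log A) := (Real.exp_log hA0).symm
      _ ≤ Real.exp (t * Real.log q) := Real.exp_le_exp.2 hle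
      _ = q ^ t := by rw [Real.exp_nat_mul, Real.exp_log hq0]
  have key : (n + 1) * ((y / rotYdagger) ^ t * (rotEnv n / y)) ≤ 1 := by
    have e1 : y / rotYdagger = q⁻¹ := by rw [hq, inv_div]
    have e2 : (n + 1) * ((y / rotYdagger) ^ t * (rotEnv n / y)) = A / q ^ t := by
      rw [e1, inv_pow, hA]; ring
    rw [e2]
    exact (div_le_one (pow_pos hq0 t)).2 hqt
  have ht1 : (t : ℝ) < τ + 1 := Nat.ceil_lt_add_one hτ0
  calc rotSurfMoment (n + 1) y / rotHpCoeff (n + 1) y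
      ≤ t + (n + 1) * ((y / rotYdagger) ^ t * (rotEnv n / y)) := rotSurfMean_succ_le_of_tail hy h.le n t
    _ ≤ 2 + τ := by linarith
    _ = 2 + Real.log ((n + 1) * rotEnv n / y) / Real.log (rotYdagger / y) := by rw [hτ, hA, hq]

/-- **Explicit rate for the density of surface vertices below the critical fugacity**: for `0 < y < y†` and every `n`,
`rotSurfDensity (n+1) y ≤ (2 + log((n+1) rotEnv n / y)/log(y†/y)) / (n+1)` (`= O_y(log n / √n)`) — an explicit rate for the
tree's `tendsto_rotSurfDensity_zero`. [cite: Beaton2014RotatedHoneycomb, §3.1, last paragraph (arXiv v3 p. 14: "the density of vertices in the surface is 0 for y < y_c")] -/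
theorem rotSurfDensity_succ_le (hy : 0 < y) (h : y < rotYdagger) (n : ℕ) :
    rotSurfDensity (n + 1) y ≤
      (2 + Real.log ((n + 1) * rotEnv n / y) / Real.log (rotYdagger / y)) / (n + 1) := by
  have hC := rotHpCoeff_succ_pos n hy
  have hn : (0 : ℝ) < (n : ℝ) + 1 := by positivity
  have e : rotSurfDensity (n + 1) y = rotSurfMoment (n + 1) y / rotHpCoeff (n + 1) y / ((n : ℝ) + 1) := by
    rw [rotSurfDensity, div_div, mul_comm]; push_cast; ring
  rw [e]
  exact div_le_div_of_nonneg_right (rotSurfMean_succ_le hy h n) hn.le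

/-! ### The envelope in closed form: `log rotEnv n ≤ 834 (⌊√n⌋+1) log(⌊√n⌋+2)` -/

/-- `μ ≤ 2` (`μ² = 2 + √2`). [cite: DuminilCopinSmirnov2012, Theorem 1 (μ = √(2+√2))] -/
private theorem mu_le_two : hexConnectiveConstant ≤ 2 := by
  have hμ := hexConnectiveConstant_pos
  have hsq : hexConnectiveConstant ^ 2 = 2 + Real.sqrt 2 := by
    rw [hexConnectiveConstant_eq_inv, inv_pow]
    exact (eq_inv_of_mul_eq_one_right hexCriticalFugacity_sq).symm
  have hs2 : Real.sqrt 2 ≤ 2 := by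
    nlinarith [Real.sq_sqrt (show (0 : ℝ) ≤ 2 by norm_num), Real.sqrt_nonneg 2]
  nlinarith

/-- `n + 1 ≤ (⌊√n⌋ + 1)²` and `log(n+1) ≤ 2 log(⌊√n⌋+2)`. [folklore] -/
private theorem log_succ_le (n : ℕ) :
    (n : ℝ) + 1 ≤ ((Nat.sqrt n : ℝ) + 1) ^ 2 ∧ Real.log ((n : ℝ) + 1) ≤ 2 * Real.log ((Nat.sqrt n : ℝ) + 2) := by
  have h : n + 1 ≤ (Nat.sqrt n + 1) * (Nat.sqrt n + 1) := Nat.lt_succ_sqrt n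
  have h1 : (n : ℝ) + 1 ≤ ((Nat.sqrt n : ℝ) + 1) ^ 2 := by
    calc (n : ℝ) + 1 = ((n + 1 : ℕ) : ℝ) := by push_cast; ring
      _ ≤ (((Nat.sqrt n + 1) * (Nat.sqrt n + 1) : ℕ) : ℝ) := by exact_mod_cast h
      _ = ((Nat.sqrt n : ℝ) + 1) ^ 2 := by push_cast; ring
  have h0 : (0 : ℝ) ≤ (Nat.sqrt n : ℝ) := Nat.cast_nonneg _
  refine ⟨h1, ?_⟩
  calc Real.log ((n : ℝ) + 1) ≤ Real.log (((Nat.sqrt n : ℝ) + 1) ^ 2) := Real.log_le_log (by positivity) h1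
    _ = 2 * Real.log ((Nat.sqrt n : ℝ) + 1) := by rw [Real.log_pow]; norm_num
    _ ≤ 2 * Real.log ((Nat.sqrt n : ℝ) + 2) := by
        have := Real.log_le_log (by linarith) (by linarith : (Nat.sqrt n : ℝ) + 1 ≤ (Nat.sqrt n : ℝ) + 2)
        linarith

/-- **`log rotEnv n ≤ 834 (⌊√n⌋+1) log(⌊√n⌋+2)`** — the envelope is `e^{O(√n log n)}` with explicit constants
(`log(n+1) ≤ 2L`, `2 log μ ≤ 2L`, `12√n ≤ 18 S L`, `log(1638 μ S²) ≤ 14 L`, `S = ⌊√n⌋+1`, `L = log(S+1) ≥ log 2`).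
[cite: Beaton2014RotatedHoneycomb, §3.1, proof of Proposition 7 (arXiv v3 pp. 13–14, (18)–(19): "e^{c√m_n}", multiplicity of the fixed-length unfolding)] -/
theorem log_rotEnv_le (n : ℕ) :
    Real.log (rotEnv n) ≤ 834 * ((Nat.sqrt n : ℝ) + 1) * Real.log ((Nat.sqrt n : ℝ) + 2) := by
  obtain ⟨hn1, hlogn⟩ := log_succ_le n
  set S : ℝ := (Nat.sqrt n : ℝ) + 1 with hS
  set L : ℝ := Real.log ((Nat.sqrt n : ℝ) + 2) with hL
  have h0 : (0 : ℝ) ≤ (Nat.sqrt n : ℝ) := Nat.cast_nonneg _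
  have hS1 : 1 ≤ S := by rw [hS]; linarith
  have hlog2 : 2 / 3 < Real.log 2 := by have := Real.log_two_gt_d9; linarith
  have hL2 : Real.log 2 ≤ L := Real.log_le_log two_pos (by rw [hS] at hS1; linarith)
  have hL0 : 0 < L := by linarith
  have hμ := hexConnectiveConstant_pos
  have hlogμ : Real.log hexConnectiveConstant ≤ L := (Real.log_le_log hμ mu_le_two).trans hL2
  have hlogS : Real.log S ≤ L := Real.log_le_log (by linarith) (by rw [hS]; linarith)
  -- `12 √n ≤ 18 S L`
  have hsqrt : Real.sqrt n ≤ S := by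
    rw [show S = Real.sqrt (S ^ 2) by rw [Real.sqrt_sq (by linarith)]]
    exact Real.sqrt_le_sqrt (by linarith)
  have h12 : 12 * Real.sqrt n ≤ 18 * S * L := by nlinarith
  -- `log B ≤ 14 L`, `B = 1638 μ S²` (`max(1, 1/y†) = 1`)
  have hmax : max 1 rotYdagger⁻¹ = 1 := max_eq_left (inv_le_one_of_one_le₀ one_lt_rotYdagger.le)
  have hBpos : 0 < 1638 * max 1 rotYdagger⁻¹ ^ 2 * hexConnectiveConstant * S ^ 2 := by rw [hmax]; positivity
  have hB : Real.log (1638 * max 1 rotYdagger⁻¹ ^ 2 * hexConnectiveConstant * S ^ 2) ≤ 14 * L := by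
    have h1638 : Real.log 1638 ≤ 11 * L := by
      calc Real.log 1638 ≤ Real.log ((2 : ℝ) ^ 11) := Real.log_le_log (by norm_num) (by norm_num)
        _ = 11 * Real.log 2 := by rw [Real.log_pow]; norm_num
        _ ≤ 11 * L := by linarith
    rw [hmax, one_pow, mul_one, Real.log_mul (by positivity) (by positivity), Real.log_mul (by norm_num) hμ.ne',
      Real.log_pow]
    push_cast
    linarith
  -- the logarithm of the product
  have e : Real.log (rotEnv n) = Real.log ((n : ℝ) + 1) + 2 * Real.log hexConnectiveConstant + 12 * Real.sqrt n +
      (58 * (Nat.sqrt n + 1) : ℕ) * Real.log (1638 * max 1 rotYdagger⁻¹ ^ 2 * hexConnectiveConstant * S ^ 2) := by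
    have ha : (n : ℝ) + 1 ≠ 0 := by positivity
    have hb : hexConnectiveConstant ^ 2 ≠ 0 := by positivity
    have hc : Real.exp (12 * Real.sqrt n) ≠ 0 := (Real.exp_pos _).ne'
    have hd : (1638 * max 1 rotYdagger⁻¹ ^ 2 * hexConnectiveConstant * S ^ 2) ^ (58 * (Nat.sqrt n + 1)) ≠ 0 :=
      (pow_pos hBpos _).ne'
    unfold rotEnv archEnv
    rw [Real.log_mul (mul_ne_zero (mul_ne_zero ha hb) hc) hd, Real.log_mul (mul_ne_zero ha hb) hc, Real.log_mul ha hb,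
      Real.log_pow, Real.log_exp, Real.log_pow]
    push_cast
    ring
  rw [e]
  push_cast
  have h58 : (58 * ((Nat.sqrt n : ℝ) + 1)) * Real.log (1638 * max 1 rotYdagger⁻¹ ^ 2 * hexConnectiveConstant * S ^ 2)
      ≤ (58 * S) * (14 * L) := by
    rw [hS]; exact mul_le_mul_of_nonneg_left hB (by positivity)
  nlinarith

/-- **`log((n+1) rotEnv n / y) ≤ 836 (⌊√n⌋+1) log(⌊√n⌋+2) - log y`** (`y > 0`).
[cite: Beaton2014RotatedHoneycomb, §3.1, proof of Proposition 7 (arXiv v3 pp. 13–14, (18)–(19))] -/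
theorem log_rotEnv_div_le (hy : 0 < y) (n : ℕ) :
    Real.log ((n + 1) * rotEnv n / y) ≤ 836 * ((Nat.sqrt n : ℝ) + 1) * Real.log ((Nat.sqrt n : ℝ) + 2) - Real.log y := by
  obtain ⟨_, hlogn⟩ := log_succ_le n
  have hE := log_rotEnv_le n
  have hE0 := rotEnv_pos n
  have h0 : (0 : ℝ) ≤ (Nat.sqrt n : ℝ) := Nat.cast_nonneg _
  have hL : Real.log 2 ≤ Real.log ((Nat.sqrt n : ℝ) + 2) := Real.log_le_log two_pos (by linarith)
  have hL0 : 0 < Real.log ((Nat.sqrt n : ℝ) + 2) := lt_of_lt_of_le (by have := Real.log_two_gt_d9; linarith) hL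
  rw [Real.log_div (by positivity) hy.ne', Real.log_mul (by positivity) hE0.ne']
  nlinarith

/-- **Closed form of the mean bound**: for `0 < y < y†` and every `n`, the mean number of surface vertices of an
`(n+1)`-vertex walk is `≤ 2 + (836 (⌊√n⌋+1) log(⌊√n⌋+2) - log y) / log(y†/y)`.
[cite: Beaton2014RotatedHoneycomb, §3.1, last paragraph (arXiv v3 p. 14: "the density of vertices in the surface is 0 for y < y_c"); HammersleyTorrieWhittington1982, §2] -/
theorem rotSurfMean_succ_le_closed (hy : 0 < y) (h : y < rotYdagger) (n : ℕ) :
    rotSurfMoment (n + 1) y / rotHpCoeff (n + 1) y ≤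
      2 + (836 * ((Nat.sqrt n : ℝ) + 1) * Real.log ((Nat.sqrt n : ℝ) + 2) - Real.log y) / Real.log (rotYdagger / y) := by
  have h1 := rotSurfMean_succ_le hy h n
  have hlogq : 0 < Real.log (rotYdagger / y) := Real.log_pos ((one_lt_div hy).2 h)
  have h2 := div_le_div_of_nonneg_right (log_rotEnv_div_le hy n) hlogq.le
  linarith

/-- **Closed form of the density rate**: for `0 < y < y†` and every `n`,
`rotSurfDensity (n+1) y ≤ (2 + (836 (⌊√n⌋+1) log(⌊√n⌋+2) - log y)/log(y†/y)) / (n+1)` — `O_y(log n/√n)`.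
[cite: Beaton2014RotatedHoneycomb, §3.1, last paragraph (arXiv v3 p. 14: "the density of vertices in the surface is 0 for y < y_c")] -/
theorem rotSurfDensity_succ_le_closed (hy : 0 < y) (h : y < rotYdagger) (n : ℕ) :
    rotSurfDensity (n + 1) y ≤
      (2 + (836 * ((Nat.sqrt n : ℝ) + 1) * Real.log ((Nat.sqrt n : ℝ) + 2) - Real.log y) /
        Real.log (rotYdagger / y)) / (n + 1) := by
  have hC := rotHpCoeff_succ_pos n hy
  have hn : (0 : ℝ) < (n : ℝ) + 1 := by positivity
  have e : rotSurfDensity (n + 1) y = rotSurfMoment (n + 1) y / rotHpCoeff (n + 1) y / ((n : ℝ) + 1) := by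
    rw [rotSurfDensity, div_div, mul_comm]; push_cast; ring
  rw [e]
  exact div_le_div_of_nonneg_right (rotSurfMean_succ_le_closed hy h n) hn.le

end HV

end Literature.Probability.RandomPlanarGeometry.SAW
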